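import Summits.CriticalPhenomena.PercolationContinuityZ3.Theorems.PercNearOneGluingNoHeavyPcintMeanMemFastMask
import HarnessLib

/-!
# PCINT lane, reduced-state B3m certificates (bond), fast kernel format: symmetry and unit-count bridges

Cell `prim-pcint` (PAPER-2 track (iii)), seat `prim-pcint-2` (gen 11); support file (`--supports stmt-CriticalPhenomena-4575`).
Does NOT build on p205010.  The symmetry bridge **`BondF.toMF_actFS`** (the table action on fast kernel states denotes the
lattice action), and the bookkeeping bridges: the probe-form unit tests of `…PcintMeanMemFast` never over-charge —
`BondF.chordF_le_bchord`, `BondF.cdetF_le_cdet`, `BondF.utF_le_ctu`, `BondF.umF_le_cmu`, `BondF.bcorner_of_cornerF` (kernel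
claims imply the semantic det-paying / bonus / t-site / corner-third / corner predicates of `…PcintChainMem` / `…ThirdMem` /
`…MeanMem` / `…ChordMem`).  The certificate theorem is in `…PcintMeanMemFastCert`.
-/

namespace Summit.CriticalPhenomena.PercolationContinuityZ3.Theorems.Pcint

open Finset Literature.Probability.Percolation Literature.Probability.LatticeModels

namespace BondF

open NawK (letters letterIdx mem_letters nodup_letters spermKL length_letters)

variable {d : ℕ}

/-! ### Symmetries -/

/-- **The table action is the lattice action** (coordinates at most `2B`, so that the flip `x ↦ 2B - x` is exact). [folklore] -/
theorem toSiteF_actF {B : ℕ} (g : SPerm d) {v : List ℕ} (hv : ∀ x ∈ v, x ≤ 2 * B) (hlen : v.length = d) :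
    (toSiteF B (actF B (spermKL g) v) : Site d) = smulSite g (toSiteF B v) := by
  funext i
  have hl : (actF B (spermKL g) v).length = d := by simp [actF, spermKL]
  have h1 : (i : ℕ) < (actF B (spermKL g) v).length := by rw [hl]; exact i.isLt
  have hx : v.getD (g.1 i) 0 ≤ 2 * B := hv _ (getD_mem (by rw [hlen]; exact (g.1 i).2))
  unfold toSiteF smulSite
  rw [getD_eq_getElem h1]
  simp only [actF, spermKL, List.getElem_map, List.getElem_ofFn]
  split_ifs with hk
  · rfl
  · push_cast [Nat.cast_sub hx]; ring

/-- **The table action on fast kernel states denotes the lattice action on states.** [folklore] -/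
theorem toMF_actFS {B : ℕ} (g : SPerm d) {L : FState} (hL : ∀ e ∈ L, e.1.length = d ∧ ∀ x ∈ e.1, x ≤ 2 * B) :
    (toMF B (actFS B (spermKL g) L) : MState d) = smulState g (toMF B L) := by
  ext q
  rw [mem_toMF, mem_smulState]
  simp only [actFS, List.mem_map]
  constructor
  · rintro ⟨x, ⟨y, hy, rfl⟩, rfl⟩
    exact ⟨toSiteF B y.1, mem_toMF.2 ⟨y, hy, rfl⟩, toSiteF_actF g (hL y hy).2 (hL y hy).1⟩
  · rintro ⟨r, hr, hq⟩
    obtain ⟨y, hy, hyq⟩ := mem_toMF.1 hr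
    simp only [Prod.mk.injEq] at hyq
    refine ⟨(actF B (spermKL g) y.1, y.2), ⟨y, hy, rfl⟩, ?_⟩
    rcases q with ⟨q1, q2⟩
    simp only [Prod.mk.injEq] at hq ⊢
    exact ⟨by rw [toSiteF_actF g (hL y hy).2 (hL y hy).1, hyq.1, hq], hyq.2⟩

/-! ### Probe sites around the new vertex -/

/-- A sum of two unit steps vanishes only for opposite letters. [folklore] -/
theorem stepVec_add_eq_zero {a b : Fin d × Bool} (h : stepVec a + stepVec b = (0 : Site d)) : b.1 = a.1 ∧ (b.2 ≠ a.2) := by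
  have hb : stepVec b = stepVec (a.1, !a.2) := by
    rw [stepVec_not]; exact eq_neg_of_add_eq_zero_right h
  have h1 : b.1 = a.1 := fst_eq_of_stepVec_eq (a := b) (b := (a.1, !a.2)) hb
  refine ⟨h1, fun h2 => ?_⟩
  have := congrFun hb b.1
  rw [stepVec_apply_fst, show (a.1, !a.2) = (b.1, !b.2) by rw [h1, h2], stepVec_apply_fst] at this
  cases hb2 : b.2 <;> simp [hb2] at this

section Sites

variable {B : ℕ} (hB : 3 ≤ B) (hB' : B ≤ 31)
include hB hB'

/-- The shifted neighbour site `e_a + e_b`: `d` coordinates, all in `[1, 62]` and within `2` of `B`, norm `≤ 2`, denoting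
`e_a + e_b`. [folklore] -/
theorem nbF_spec (a b : Fin d × Bool) :
    (nbF d B a b).length = d ∧ (∀ x ∈ nbF d B a b, 1 ≤ x) ∧ (∀ x ∈ nbF d B a b, x ≤ 62) ∧ l1F B (nbF d B a b) ≤ 2 ∧
      (toSiteF B (nbF d B a b) : Site d) = stepVec a + stepVec b ∧ (∀ x ∈ nbF d B a b, B ≤ x + 2 ∧ x ≤ B + 2) := by
  obtain ⟨hlen, hbd, hl1⟩ := unitF_spec (d := d) (B := B) (by omega) a
  have hwin : ∀ x ∈ nbF d B a b, B ≤ x + 2 ∧ x ≤ B + 2 := fun x hx => by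
    have h1 := addU_ge (n := B - 2) _ _ _ (fun y hy => by have := (hbd y hy).1; omega) x (by rw [nbF] at hx; exact hx)
    have h2 := addU_le _ _ _ (fun y hy => (hbd y hy).2) x (by rw [nbF] at hx; exact hx)
    omega
  refine ⟨by rw [nbF, length_addU, hlen], fun x hx => ?_, fun x hx => ?_, ?_, ?_, hwin⟩
  · have := (hwin x hx).1; omega
  · have := (hwin x hx).2; omega
  · have := l1F_addU_le (B := B) (unitF d B a) b.1.1 b.2; rw [nbF]; omega
  · rw [nbF, toSiteF_addU hlen (fun x hx => by have := (hbd x hx).1; omega) b, toSiteF_unitF (by omega)]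

end Sites

/-! ### The unit-count bridges -/

section Units

variable {B τ kc : ℕ} {L : FState} (hL : WFF d B L = true) (hself : selfOK (locOf B kc L) = true) (hB : 3 ≤ B) (hB' : B ≤ 31)
include hL hself hB hB'

omit hself in
/-- **A kernel det-paying letter is a det-paying site.** [folklore] -/
theorem mem_cdetSet_of_payF {a b : Fin d × Bool} (h : payF d B (locOf B kc L) a b = true) :
    stepVec a + stepVec b ∈ cdetSet kc (toMF B L : MState d) a := by
  classical
  obtain ⟨hw, hw1, -, hw2, hsite, hwin⟩ := nbF_spec hB hB' a b (d := d)
  unfold payF at h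
  simp only [Bool.and_eq_true, Bool.not_eq_true', beq_iff_eq, beq_eq_false_iff_ne, ne_eq] at h
  obtain ⟨⟨⟨horig, hrem⟩, hdet⟩, hlink⟩ := h
  rw [cdetSet, mem_filter, mem_nbrSites]
  refine ⟨(zdGraph_adj_iff_stepVec _ _).2 ⟨b, rfl⟩, fun h0 => ?_, ?_, ?_, ?_⟩
  · obtain ⟨h1, h2⟩ := stepVec_add_eq_zero h0
    have : (decide (b.1 = a.1) && !(b.2 == a.2)) = true := by
      rw [Bool.and_eq_true, decide_eq_true_eq]; exact ⟨h1, by simpa using h2⟩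
    rw [this] at horig; exact Bool.noConfusion horig
  · rw [← hsite]; exact forall_ne_of_mask hL hw (by omega) hrem
  · obtain ⟨e, he, he2, k, -, hadj⟩ := exists_of_mask hL hw hw1 hwin hdet
    refine ⟨(toSiteF B e.1, e.2), mem_bcinc.2 ⟨mem_toMF.2 ⟨e, he, rfl⟩, by rw [← hsite]; exact hadj⟩, ?_⟩
    simpa using he2
  · obtain ⟨e, he, he2, k, -, hadj⟩ := exists_of_mask hL hw hw1 hwin hlink
    refine ⟨(toSiteF B e.1, e.2), mem_bcinc.2 ⟨mem_toMF.2 ⟨e, he, rfl⟩, by rw [← hsite]; exact hadj⟩, ?_⟩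
    simpa using he2

/-- **A kernel bonus is a bonus.** [folklore] -/
theorem bcbonus_of_bonusF {a b : Fin d × Bool} (h : bonusF d B τ kc (locOf B kc L) a b = true) :
    bcbonus τ kc (toMF B L : MState d) (stepVec a + stepVec b) := by
  have hall := WFF_spec hL
  obtain ⟨hw, hw1, hw62, hw2, hsite, hwin⟩ := nbF_spec hB hB' a b (d := d)
  unfold bonusF at h
  rw [List.any_eq_true] at h
  obtain ⟨k, -, h⟩ := h
  simp only [Bool.and_eq_true, List.all_eq_true, Bool.or_eq_true, beq_iff_eq, decide_eq_true_eq] at h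
  obtain ⟨⟨⟨hk1, hkc⟩, hkτ⟩, hall'⟩ := h
  obtain ⟨e₁, he₁, he₁1, he₁2, hadj₁⟩ := exists_of_nbAge hL (by omega) hw hw1 hw62 rfl
    (show nbAge B (locOf B kc L) (nbF d B a b) k ≠ 0 by omega)
  refine ⟨(toSiteF B e₁.1, e₁.2), mem_bcinc.2 ⟨mem_toMF.2 ⟨e₁, he₁, rfl⟩, by rw [← hsite]; exact hadj₁⟩,
    by rw [he₁2]; exact hkc, by rw [he₁2]; exact hkτ, fun q hq hne => ?_⟩
  obtain ⟨hqS, hqadj⟩ := mem_bcinc.1 hq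
  obtain ⟨e, he, rfl⟩ := mem_toMF.1 hqS
  rw [← hsite] at hqadj
  obtain ⟨k', hk', hage⟩ := nbAge_of_adj hL hself hw hw1 hw2 he hqadj.symm
  rcases hall' k' (mem_letters k') with (rfl | h0) | hlt
  · -- same direction: same site, hence (self-check) same age: the incidence IS `q₁`
    refine absurd ?_ hne
    have hs : e.1 = e₁.1 := by rw [hk', he₁1]
    have ha : e.2 = e₁.2 := by rw [← hage, ← he₁2]
    simp only [hs, ha]
  · have := (hall e he).2.1; rw [← hage, h0] at this; omega
  · rw [he₁2]; rw [hage] at hlt; exact hlt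

/-- **A kernel t-site is a t-site.** [folklore] -/
theorem mem_ctSet_of_tF {a b : Fin d × Bool} (h : tF d B (locOf B kc L) a b = true) :
    stepVec a + stepVec b ∈ ctSet kc (toMF B L : MState d) a := by
  classical
  have hall := WFF_spec hL
  obtain ⟨hw, hw1, hw62, hw2, hsite, hwin⟩ := nbF_spec hB hB' a b (d := d)
  unfold tF at h
  simp only [Bool.and_eq_true, List.all_eq_true, Bool.or_eq_true, beq_iff_eq, decide_eq_true_eq] at h
  obtain ⟨⟨hpay, htwo⟩, hall3⟩ := h
  rw [ctSet, mem_filter]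
  refine ⟨mem_cdetSet_of_payF hL hB hB' hpay, ?_, fun q hq => ?_⟩
  · -- two distinct directions with nonzero probes give two distinct incidences
    set l := (letters d).filter fun k => !(nbAge B (locOf B kc L) (nbF d B a b) k == 0) with hl
    have hlnd : l.Nodup := nodup_letters.filter _
    have h0 : 0 < l.length := by omega
    have h1 : 1 < l.length := by omega
    have hm0 := List.mem_filter.1 (List.getElem_mem h0)
    have hm1 := List.mem_filter.1 (List.getElem_mem h1)
    have hne : l[0] ≠ l[1] := fun h => by have := (List.Nodup.getElem_inj_iff hlnd).1 h; omega
    have hp0 : nbAge B (locOf B kc L) (nbF d B a b) l[0] ≠ 0 := by simpa using hm0.2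
    have hp1 : nbAge B (locOf B kc L) (nbF d B a b) l[1] ≠ 0 := by simpa using hm1.2
    obtain ⟨e₀, he₀, he₀1, -, hadj₀⟩ := exists_of_nbAge hL (by omega) hw hw1 hw62 rfl hp0
    obtain ⟨e₁, he₁, he₁1, -, hadj₁⟩ := exists_of_nbAge hL (by omega) hw hw1 hw62 rfl hp1
    refine one_lt_card.2 ⟨(toSiteF B e₀.1, e₀.2), mem_bcinc.2 ⟨mem_toMF.2 ⟨e₀, he₀, rfl⟩, by rw [← hsite]; exact hadj₀⟩,
      (toSiteF B e₁.1, e₁.2), mem_bcinc.2 ⟨mem_toMF.2 ⟨e₁, he₁, rfl⟩, by rw [← hsite]; exact hadj₁⟩, fun heq => hne ?_⟩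
    have hs : (toSiteF B e₀.1 : Site d) = toSiteF B e₁.1 := congrArg Prod.fst heq
    rw [he₀1, he₁1, toSiteF_addU hw hw1, toSiteF_addU hw hw1] at hs
    exact BondK.stepVec_add_injective (l[0])
      (show stepVec l[0] + stepVec l[0] = stepVec l[0] + stepVec l[1] by rw [add_left_cancel hs])
  · obtain ⟨hqS, hqadj⟩ := mem_bcinc.1 hq
    obtain ⟨e, he, rfl⟩ := mem_toMF.1 hqS
    rw [← hsite] at hqadj
    obtain ⟨k', -, hage⟩ := nbAge_of_adj hL hself hw hw1 hw2 he hqadj.symm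
    rcases hall3 k' (mem_letters k') with h0 | h3
    · have := (hall e he).2.1; rw [← hage, h0] at this; omega
    · rw [hage] at h3; exact h3

omit hself in
/-- **A kernel corner-third letter is a corner-third site.** [folklore] -/
theorem mem_cm3Set_of_m3F {a b : Fin d × Bool} (h : m3F d B (locOf B kc L) a b = true) :
    stepVec a + stepVec b ∈ cm3Set kc (toMF B L : MState d) a := by
  classical
  unfold m3F at h
  simp only [Bool.and_eq_true, Bool.not_eq_true', decide_eq_false_iff_not, beq_iff_eq] at h
  obtain ⟨⟨hpay, hperp⟩, hage⟩ := h
  rw [cm3Set, mem_filter]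
  refine ⟨mem_cdetSet_of_payF hL hB hB' hpay, ?_⟩
  obtain ⟨hlen, hbd, -⟩ := unitF_spec (d := d) (B := B) (by omega) b
  obtain ⟨e, he, he1, he2⟩ := exists_of_ageAt hL (by omega) hlen (fun x hx => by have := (hbd x hx).2; omega) hage
    one_ne_zero
  refine ⟨(toSiteF B e.1, e.2), mem_toMF.2 ⟨e, he, rfl⟩, he2, ?_, ?_⟩
  · simp only; rw [he1, toSiteF_unitF (by omega)]; exact stepVec_apply_of_ne b (Ne.symm hperp)
  · simp only; rw [he1, toSiteF_unitF (by omega), add_comm]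

omit hself hB hB' in
/-- **A kernel corner claim is a corner claim.** [folklore] -/
theorem bcorner_of_cornerF {a : Fin d × Bool} (h : cornerF d B (locOf B kc L) L a = true) :
    bcorner (toMF B L : MState d) a = true := by
  have hall := WFF_spec hL
  unfold cornerF at h
  cases hf : L.find? (fun e => e.2 == 1) with
  | none => rw [hf] at h; exact Bool.noConfusion h
  | some e =>
    rw [hf] at h
    simp only [Bool.and_eq_true, beq_iff_eq] at h
    obtain ⟨⟨⟨hl1, hcoord⟩, hrem⟩, hinc⟩ := h
    have he : e ∈ L := List.mem_of_find?_eq_some hf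
    have he1 : e.2 = 1 := by simpa using List.find?_some hf
    have hel : e.1.length = d := (hall e he).1
    have he1' : ∀ x ∈ e.1, 1 ≤ x := fun x hx => by have := ((hall e he).2.2 x hx).1; omega
    have hcl : (addU e.1 a.1.1 a.2).length = d := by rw [length_addU, hel]
    have hc1 : ∀ x ∈ addU e.1 a.1.1 a.2, 1 ≤ x := addU_ge _ _ _ fun x hx => ((hall e he).2.2 x hx).1
    have hc2 : l1F B (addU e.1 a.1.1 a.2) ≤ 2 := by have := l1F_addU_le (B := B) e.1 a.1.1 a.2; omega
    have hcs : (toSiteF B (addU e.1 a.1.1 a.2) : Site d) = toSiteF B e.1 + stepVec a := toSiteF_addU hel he1' a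
    unfold bcorner
    rw [decide_eq_true_iff]
    refine ⟨(toSiteF B e.1, e.2), mem_toMF.2 ⟨e, he, rfl⟩, he1, ?_, fun q hq => ?_, fun q hq hq2 hadj => ?_⟩
    · show ((e.1.getD a.1.1 0 : ℕ) : ℤ) - B = 0
      rw [hcoord, sub_self]
    · simp only; rw [← hcs]; exact forall_ne_of_mask hL hcl (by omega) hrem q hq
    · obtain ⟨e', he', rfl⟩ := mem_toMF.1 hq
      simp only at hq2 hadj
      rw [← hcs] at hadj
      exact forall_not_adj_of_mask hL hcl hc1 hc2 hinc e' he' (by simpa using hq2) hadj.symm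

omit hself in
/-- **The kernel chord count does not exceed the detected chord count.** [folklore] -/
theorem chordF_le_bchord (a : Fin d × Bool) : chordF d B (locOf B kc L) a ≤ bchord (toMF B L : MState d) a := by
  classical
  have hall := WFF_spec hL
  obtain ⟨hw, hbd, hl1⟩ := unitF_spec (d := d) (B := B) (by omega) a
  have hw1 : ∀ x ∈ unitF d B a, 1 ≤ x := fun x hx => by have := (hbd x hx).1; omega
  unfold chordF bchord
  set P : Fin d × Bool → Bool := fun k => !((locOf B kc L).2.2.1 &&& 2 ^ cell7 B (addU (unitF d B a) k.1.1 k.2) == 0) with hP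
  have hnd : ((letters d).filter fun k => P k).Nodup := nodup_letters.filter _
  rw [← List.toFinset_card_of_nodup hnd]
  calc (((letters d).filter fun k => P k).toFinset).card
      ≤ ((bchordSet (toMF B L : MState d) a).image Prod.fst).card := by
        refine Finset.card_le_card_of_injOn (fun k => stepVec a + stepVec k) (fun k hk => ?_)
          (fun k _ k' _ h => BondK.stepVec_add_injective a h)
        rw [Finset.mem_coe, List.mem_toFinset, List.mem_filter] at hk
        have hk0 : (locOf B kc L).2.2.1 &&& 2 ^ cell7 B (addU (unitF d B a) k.1.1 k.2) ≠ 0 := by simpa [hP] using hk.2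
        obtain ⟨i, hi1, hi2⟩ := exists_testBit_of_land_ne_zero hk0
        rw [Nat.testBit_two_pow, decide_eq_true_eq] at hi2
        obtain ⟨x, hx, -, hxi⟩ := testBit_occOf.1 hi1
        obtain ⟨e, he, he3, rfl⟩ := mem_nearL.1 hx
        simp only at hxi
        have heq : e.1 = addU (unitF d B a) k.1.1 k.2 := by
          refine cell7_inj (by rw [length_addU, hw]; exact (hall e he).1) (bound_of_l1F he3) (fun x hx => ?_) (by rw [hxi, hi2])
          have h1 := addU_ge (n := B - 2) (unitF d B a) k.1.1 k.2 (fun y hy => by have := (hbd y hy).1; omega) x hx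
          have h2 := addU_le (m := B + 1) (unitF d B a) k.1.1 k.2 (fun y hy => (hbd y hy).2) x hx
          omega
        have hadj : (zdGraph d).Adj (toSiteF B e.1 : Site d) (stepVec a) := by
          rw [heq, toSiteF_addU hw hw1 k, toSiteF_unitF (by omega)]
          exact ((zdGraph_adj_iff_stepVec _ _).2 ⟨k, rfl⟩).symm
        rw [Finset.mem_coe, Finset.mem_image]
        refine ⟨(toSiteF B e.1, e.2), ?_, ?_⟩
        · rw [bchordSet, Finset.mem_filter]
          exact ⟨mem_toMF.2 ⟨e, he, rfl⟩, hadj⟩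
        · simp only; rw [heq, toSiteF_addU hw hw1 k, toSiteF_unitF (by omega)]
    _ ≤ (bchordSet (toMF B L : MState d) a).card := Finset.card_image_le

/-- **Deterministic units are not over-claimed.** [folklore] -/
theorem cdetF_le_cdet (a : Fin d × Bool) : cdetF d B τ kc (locOf B kc L) a ≤ cdet τ kc (toMF B L : MState d) a := by
  classical
  unfold cdetF cdet
  refine add_le_add ?_ ?_
  · have hnd : ((letters d).filter fun b => payF d B (locOf B kc L) a b).Nodup := nodup_letters.filter _
    rw [← List.toFinset_card_of_nodup hnd]
    refine Finset.card_le_card_of_injOn (fun b => stepVec a + stepVec b) (fun b hb => ?_)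
      (fun b _ b' _ h => BondK.stepVec_add_injective a h)
    rw [Finset.mem_coe, List.mem_toFinset, List.mem_filter] at hb
    rw [Finset.mem_coe]
    exact mem_cdetSet_of_payF hL hB hB' hb.2
  · have hnd : ((letters d).filter fun b => payF d B (locOf B kc L) a b && bonusF d B τ kc (locOf B kc L) a b).Nodup :=
      nodup_letters.filter _
    rw [← List.toFinset_card_of_nodup hnd]
    refine Finset.card_le_card_of_injOn (fun b => stepVec a + stepVec b) (fun b hb => ?_)
      (fun b _ b' _ h => BondK.stepVec_add_injective a h)
    rw [Finset.mem_coe, List.mem_toFinset, List.mem_filter] at hb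
    obtain ⟨-, hb⟩ := hb
    rw [Bool.and_eq_true] at hb
    rw [Finset.mem_coe, Finset.mem_filter]
    exact ⟨mem_cdetSet_of_payF hL hB hB' hb.1, bcbonus_of_bonusF hL hself hB hB' hb.2⟩

/-- **`t`-units are not over-claimed.** [folklore] -/
theorem utF_le_ctu (a : Fin d × Bool) : utF d B (locOf B kc L) a ≤ ctu kc (toMF B L : MState d) a := by
  classical
  unfold utF ctu
  have hnd : ((letters d).filter fun b => tF d B (locOf B kc L) a b).Nodup := nodup_letters.filter _
  rw [← List.toFinset_card_of_nodup hnd]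
  refine Finset.card_le_card_of_injOn (fun b => stepVec a + stepVec b) (fun b hb => ?_)
    (fun b _ b' _ h => BondK.stepVec_add_injective a h)
  rw [Finset.mem_coe, List.mem_toFinset, List.mem_filter] at hb
  rw [Finset.mem_coe]
  exact mem_ctSet_of_tF hL hself hB hB' hb.2

omit hself in
/-- **Corner-third units are not over-claimed.** [folklore] -/
theorem umF_le_cmu (a : Fin d × Bool) : umF d B (locOf B kc L) a ≤ cmu kc (toMF B L : MState d) a := by
  classical
  unfold umF cmu
  have hnd : ((letters d).filter fun b => m3F d B (locOf B kc L) a b).Nodup := nodup_letters.filter _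
  rw [← List.toFinset_card_of_nodup hnd]
  refine Finset.card_le_card_of_injOn (fun b => stepVec a + stepVec b) (fun b hb => ?_)
    (fun b _ b' _ h => BondK.stepVec_add_injective a h)
  rw [Finset.mem_coe, List.mem_toFinset, List.mem_filter] at hb
  rw [Finset.mem_coe]
  exact mem_cm3Set_of_m3F hL hB hB' hb.2

omit hL hself hB hB' in
/-- The claimed counts are at most `4d`, `2d`, `2d`, `2d`. [folklore] -/
theorem counts_le (P : LMap) (a : Fin d × Bool) :
    cdetF d B τ kc P a ≤ 4 * d ∧ utF d B P a ≤ 2 * d ∧ umF d B P a ≤ 2 * d ∧ chordF d B P a ≤ 2 * d := by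
  have h := fun (p : Fin d × Bool → Bool) => (List.length_filter_le p (letters d)).trans (le_of_eq length_letters)
  unfold cdetF utF umF chordF
  refine ⟨?_, h _, h _, h _⟩
  have := h (fun b => payF d B P a b); have := h (fun b => payF d B P a b && bonusF d B τ kc P a b); omega

end Units

end BondF

end Summit.CriticalPhenomena.PercolationContinuityZ3.Theorems.Pcint
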